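import Summits.CriticalPhenomena.PercolationContinuityZ3.Theorems.PercNearOneGluingNoHeavyLowerTailSahiCTCC2ThreeSliceS
import Summits.CriticalPhenomena.PercolationContinuityZ3.Theorems.PercNearOneGluingNoHeavyLowerTailSahiCTCC2LevelTwoVertex
import Summits.CriticalPhenomena.PercolationContinuityZ3.Theorems.PercNearOneGluingNoHeavyLowerTailSahiCTCRtForm
import HarnessLib

/-!
# `NoHeavyLowerTail` (crux stmt-CriticalPhenomena-4575), P3 lane: the rows of `R_3` with a DOUBLED POINT as squarefree coefficients —
# the `s_d²` slice of `R_3 = Θ₂·(Π·Y₃ − X·Z) + Π·X₂·Z₂` in the deletions `𝒳⁰ = delV d 𝒳` and links `𝒳¹ = linkV d 𝒳`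

Support file (seat `prim-l12-p3`, gen 51; `--supports stmt-CriticalPhenomena-4575`).  Memo
`run/shared/lean/prim/prim-l12/FROM-prim-l12-p3-g51-ROW0-ALL-K-LEAN.md` §5 (first brick of rows 1–2 of the open core `hLF`; paper proof:
`FROM-prim-l12-p3-g50-KLEITMAN-BULK.md` §3.2, §4.1).

For a profile `n` avoiding `d`, `coeff_{n + 2e_d} R_3(𝒳,𝒵)` only sees products with exactly two factors through `d`
(`…C2ThreeSliceS.coeff_gf3_add_single_two`).  With `Θ₂' = delV d Θ₂` (sets of size `< 3` avoiding `d`), `Θ₁' = delV d Θ₁` (`= linkV d Θ₂`),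
`Π' = delV d 2^α` (`= linkV d 2^α`), `X⁰ = delV d 𝒳`, `X¹ = linkV d 𝒳` (likewise `Z⁰, Z¹`):
* `coeff_Rt_three_add_single_two` : the raw slice (nine triple products of deletions/links of `Θ₂, 2^α, Y₃, 𝒳, 𝒵, X₂, Z₂`);
* `linkV_bySize_lt_three`, `delV_atLeast_inter`, `linkV_atLeast_three_inter`, `delV_below`, `linkV_below_three` : the deletions/links of the fixed
  and derived families;
* **`coeff_Rt_three_add_single_two_eq`** (g50 §3.2):
  `coeff_{n+2e_d} R_3 = coeff_n { Θ₁'Π'(Y⁰⁰_{≥3} + Y¹¹_{≥2}) + Θ₂'Π'Y¹¹_{≥2} − Θ₁'(X¹Z⁰ + X⁰Z¹) − Θ₂'X¹Z¹ + Π'(X¹_{<2}Z⁰_{<3} + X⁰_{<3}Z¹_{<2} + X¹_{<2}Z¹_{<2}) }`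
  with `Y⁰⁰ = X⁰ ∩ Z⁰`, `Y¹¹ = X¹ ∩ Z¹` — a `d`-free polynomial in up-sets on `α ∖ {d}` whose squarefree coefficients are the rows with one doubled point.
No new definitions; nothing is asserted about the crux.
-/

noncomputable section

open scoped Classical

namespace Summit.CriticalPhenomena.PercolationContinuityZ3.Theorems.SahiCTCForms

open Finset MvPolynomial SahiCTCGenFun

variable {α : Type*} [DecidableEq α] [Fintype α]

/-- **The raw `s_d²` slice of `R_3`** at a `d`-free profile `n`. [this work] -/
theorem coeff_Rt_three_add_single_two (F G : Finset (Finset α)) (d : α) {n : α →₀ ℕ} (hn : n d = 0) :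
    (Rt 3 F G).coeff (n + Finsupp.single d 2) =
      (gf (linkV d (bySize (· < 3) : Finset (Finset α))) * gf (delV d (univ.powerset : Finset (Finset α))) * gf (delV d (atLeast 3 (F ∩ G)))
        + gf (linkV d (bySize (· < 3) : Finset (Finset α))) * gf (delV d (univ.powerset : Finset (Finset α))) * gf (linkV d (atLeast 3 (F ∩ G)))
        + gf (delV d (bySize (· < 3) : Finset (Finset α))) * gf (delV d (univ.powerset : Finset (Finset α))) * gf (linkV d (atLeast 3 (F ∩ G)))
      - (gf (linkV d (bySize (· < 3) : Finset (Finset α))) * gf (linkV d F) * gf (delV d G)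
        + gf (linkV d (bySize (· < 3) : Finset (Finset α))) * gf (delV d F) * gf (linkV d G)
        + gf (delV d (bySize (· < 3) : Finset (Finset α))) * gf (linkV d F) * gf (linkV d G))
      + (gf (delV d (univ.powerset : Finset (Finset α))) * gf (linkV d (below 3 F)) * gf (delV d (below 3 G))
        + gf (delV d (univ.powerset : Finset (Finset α))) * gf (delV d (below 3 F)) * gf (linkV d (below 3 G))
        + gf (delV d (univ.powerset : Finset (Finset α))) * gf (linkV d (below 3 F)) * gf (linkV d (below 3 G)))).coeff n := by
  have hR : Rt 3 F G = gf (bySize (· < 3) : Finset (Finset α)) * gf (univ.powerset : Finset (Finset α)) * gf (atLeast 3 (F ∩ G))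
      - gf (bySize (· < 3) : Finset (Finset α)) * gf F * gf G
      + gf (univ.powerset : Finset (Finset α)) * gf (below 3 F) * gf (below 3 G) := by
    unfold Rt PiP; ring
  rw [hR, coeff_add, coeff_sub, coeff_gf3_add_single_two _ _ _ d hn, coeff_gf3_add_single_two _ _ _ d hn, coeff_gf3_add_single_two _ _ _ d hn,
    linkV_powerset_eq]
  simp only [coeff_add, coeff_sub]

/-! ### Deletions and links of the fixed and derived families -/

section DelLink
variable (F G : Finset (Finset α)) (d : α)

/-- `linkV d Θ₂ = delV d Θ₁`: the sets `T ∌ d` with `#(T + d) < 3` are those with `#T < 2`. [this work] -/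
theorem linkV_bySize_lt_three : linkV d (bySize (· < 3) : Finset (Finset α)) = delV d (bySize (· < 2)) := by
  ext S
  simp only [linkV, delV, bySize, mem_filter, mem_powerset, subset_univ, true_and, subset_erase]
  constructor
  · rintro ⟨hd, h⟩; rw [card_insert_of_notMem hd] at h; exact ⟨by omega, hd⟩
  · rintro ⟨h, hd⟩; rw [card_insert_of_notMem hd]; exact ⟨hd, by omega⟩

omit [Fintype α] in
/-- `delV d (Y_{≥3}) = (X⁰ ∩ Z⁰)_{≥3}`. [this work] -/
theorem delV_atLeast_inter : delV d (atLeast 3 (F ∩ G)) = atLeast 3 (delV d F ∩ delV d G) := by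
  unfold atLeast; rw [delV_filter, delV_inter]

/-- `linkV d (Y_{≥3}) = (X¹ ∩ Z¹)_{≥2}`. [this work] -/
theorem linkV_atLeast_three_inter : linkV d (atLeast 3 (F ∩ G)) = atLeast 2 (linkV d F ∩ linkV d G) := by
  unfold atLeast
  rw [linkV_filter, linkV_inter]
  refine filter_congr fun S hS => ?_
  rw [card_insert_of_notMem (not_mem_of_mem_linkV (mem_inter.1 hS).1)]
  omega

omit [Fintype α] in
/-- `delV d (X_{<3}) = (X⁰)_{<3}`. [this work] -/
theorem delV_below : delV d (below 3 F) = below 3 (delV d F) := by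
  unfold below; rw [delV_filter]

/-- `linkV d (X_{<3}) = (X¹)_{<2}`. [this work] -/
theorem linkV_below_three : linkV d (below 3 F) = below 2 (linkV d F) := by
  unfold below
  rw [linkV_filter]
  refine filter_congr fun S hS => ?_
  rw [card_insert_of_notMem (not_mem_of_mem_linkV hS)]
  omega

end DelLink

/-- **THE ROW WITH ONE DOUBLED POINT AS A `d`-FREE COEFFICIENT** (g50 §3.2): for a `d`-free profile `n`,
`coeff_{n+2e_d} R_3(𝒳,𝒵) = coeff_n { Θ₁'Π'(Y⁰⁰_{≥3} + Y¹¹_{≥2}) + Θ₂'Π'Y¹¹_{≥2} − Θ₁'(X¹Z⁰ + X⁰Z¹) − Θ₂'X¹Z¹ + Π'(X¹_{<2}Z⁰_{<3} + X⁰_{<3}Z¹_{<2} + X¹_{<2}Z¹_{<2}) }`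
(`Θ₂' = delV d Θ₂`, `Θ₁' = delV d Θ₁`, `Π' = delV d 2^α`, `X⁰ = delV d 𝒳`, `X¹ = linkV d 𝒳`). [this work] -/
theorem coeff_Rt_three_add_single_two_eq (F G : Finset (Finset α)) (d : α) {n : α →₀ ℕ} (hn : n d = 0) :
    (Rt 3 F G).coeff (n + Finsupp.single d 2) =
      (gf (delV d (bySize (· < 2) : Finset (Finset α))) * gf (delV d (univ.powerset : Finset (Finset α))) * gf (atLeast 3 (delV d F ∩ delV d G))
        + gf (delV d (bySize (· < 2) : Finset (Finset α))) * gf (delV d (univ.powerset : Finset (Finset α))) * gf (atLeast 2 (linkV d F ∩ linkV d G))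
        + gf (delV d (bySize (· < 3) : Finset (Finset α))) * gf (delV d (univ.powerset : Finset (Finset α))) * gf (atLeast 2 (linkV d F ∩ linkV d G))
      - (gf (delV d (bySize (· < 2) : Finset (Finset α))) * gf (linkV d F) * gf (delV d G)
        + gf (delV d (bySize (· < 2) : Finset (Finset α))) * gf (delV d F) * gf (linkV d G)
        + gf (delV d (bySize (· < 3) : Finset (Finset α))) * gf (linkV d F) * gf (linkV d G))
      + (gf (delV d (univ.powerset : Finset (Finset α))) * gf (below 2 (linkV d F)) * gf (below 3 (delV d G))
        + gf (delV d (univ.powerset : Finset (Finset α))) * gf (below 3 (delV d F)) * gf (below 2 (linkV d G))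
        + gf (delV d (univ.powerset : Finset (Finset α))) * gf (below 2 (linkV d F)) * gf (below 2 (linkV d G)))).coeff n := by
  rw [coeff_Rt_three_add_single_two F G d hn, linkV_bySize_lt_three, delV_atLeast_inter, linkV_atLeast_three_inter, delV_below, delV_below,
    linkV_below_three, linkV_below_three]

end Summit.CriticalPhenomena.PercolationContinuityZ3.Theorems.SahiCTCForms
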